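import Mathlib.RingTheory.Ideal.MinimalPrime.Localization
import Mathlib.RingTheory.Localization.AtPrime.Basic
import Mathlib.RingTheory.Localization.Submodule
import Mathlib.RingTheory.Noetherian.Basic
import Mathlib.RingTheory.Finiteness.Ideal
import HarnessLib

/-!
# Colon capturing, step CC1: the multiplier attached to a minimal prime

Let `S` be a Noetherian ring and `Q` a minimal prime of an ideal `J ≤ S`.  We prove that there
are `c ∉ Q` and `N : ℕ` with `c * z ∈ J` for every `z ∈ Q ^ N`, i.e. `c • Q ^ N ⊆ J`.

Proof.  In the localization `S_Q` the radical of `J S_Q` is the maximal ideal `Q S_Q`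
(`IsLocalization.AtPrime.radical_map_of_mem_minimalPrimes`), and `S_Q` is Noetherian, so
`(Q S_Q) ^ N ≤ J S_Q` for some `N`.  Hence every `g ∈ Q ^ N` maps into `J S_Q`; clearing the
denominator (`IsLocalization.mem_map_algebraMap_iff`, `IsLocalization.eq_iff_exists`) gives
`b ∉ Q` with `b * g ∈ J`.  Finally `Q ^ N` is finitely generated, and the product `c` of the
elements `b` attached to a finite generating set works for all of `Q ^ N`.
-/

-- single-problem summit: the doubled namespace component is forced
set_option linter.dupNamespace false

noncomputable section

namespace Summit.ResolutionOfSingularities.ResolutionOfSingularities.Theorems.FRationalResolution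

/-- Pointwise version: if `Q` is a minimal prime of `J` in a Noetherian ring, there is `N : ℕ`
such that every `g ∈ Q ^ N` admits some `b ∉ Q` with `b * g ∈ J` (clear denominators in
`(Q S_Q) ^ N ≤ J S_Q`). -/
theorem colonCapturing_exists_mul_pow_mem_pointwise (S : Type) [CommRing S] [IsNoetherianRing S]
    (J Q : Ideal S) (hQ : Q ∈ J.minimalPrimes) :
    ∃ N : ℕ, ∀ g ∈ Q ^ N, ∃ b : S, b ∉ Q ∧ b * g ∈ J := by
  haveI hQp : Q.IsPrime := hQ.1.1
  -- in `S_Q` the radical of `J S_Q` is `Q S_Q`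
  have hrad : (J.map (algebraMap S (Localization.AtPrime Q))).radical =
      Q.map (algebraMap S (Localization.AtPrime Q)) :=
    IsLocalization.AtPrime.radical_map_of_mem_minimalPrimes (Localization.AtPrime Q) Q J hQ
  obtain ⟨N, hN⟩ := Ideal.exists_pow_le_of_le_radical_of_fg hrad.ge (IsNoetherian.noetherian _)
  refine ⟨N, fun g hg => ?_⟩
  have hgA : algebraMap S (Localization.AtPrime Q) g ∈
      J.map (algebraMap S (Localization.AtPrime Q)) := by
    refine hN ?_
    rw [← Ideal.map_pow]
    exact Ideal.mem_map_of_mem _ hg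
  rw [IsLocalization.mem_map_algebraMap_iff Q.primeCompl (Localization.AtPrime Q)] at hgA
  obtain ⟨⟨a, s⟩, h⟩ := hgA
  rw [← map_mul, IsLocalization.eq_iff_exists Q.primeCompl (Localization.AtPrime Q)] at h
  obtain ⟨t, ht⟩ := h
  refine ⟨((t * s : Q.primeCompl) : S), (t * s).2, ?_⟩
  -- `(t s) g = t (g s) = t a ∈ J`
  have hts : ((t * s : Q.primeCompl) : S) * g = (t : S) * (a : S) := by
    rw [← ht, Submonoid.coe_mul]
    ring
  rw [hts]
  exact J.mul_mem_left _ a.2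

/-- **CC1 (the colon-capturing multiplier).** If `Q` is a minimal prime of an ideal `J` in a
Noetherian ring `S`, then some `c ∉ Q` and `N : ℕ` satisfy `c * z ∈ J` for all `z ∈ Q ^ N`,
i.e. `c • Q ^ N ⊆ J`. -/
theorem colonCapturing_exists_mul_pow_mem (S : Type) [CommRing S] [IsNoetherianRing S]
    (J Q : Ideal S) (hQ : Q ∈ J.minimalPrimes) :
    ∃ c : S, c ∉ Q ∧ ∃ N : ℕ, ∀ z ∈ Q ^ N, c * z ∈ J := by
  classical
  haveI hQp : Q.IsPrime := hQ.1.1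
  obtain ⟨N, hN⟩ := colonCapturing_exists_mul_pow_mem_pointwise S J Q hQ
  choose! b hbQ hbJ using hN
  -- a finite generating set `T` of `Q ^ N`
  obtain ⟨T, hT⟩ : (Q ^ N).FG := IsNoetherian.noetherian _
  have hTQ : ∀ g ∈ T, g ∈ Q ^ N := fun g hg => by
    rw [← hT]
    exact Submodule.subset_span (Finset.mem_coe.mpr hg)
  refine ⟨∏ g ∈ T, b g, ?_, N, fun z hz => ?_⟩
  · -- a finite product of elements outside the prime `Q` lies outside `Q`
    rw [Ideal.IsPrime.prod_mem_iff]
    rintro ⟨g, hg, hgQ⟩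
    exact hbQ g (hTQ g hg) hgQ
  · rw [← hT] at hz
    induction hz using Submodule.span_induction with
    | mem g hg =>
      rw [← Finset.prod_erase_mul T b (Finset.mem_coe.mp hg), mul_assoc]
      exact J.mul_mem_left _ (hbJ g (hTQ g (Finset.mem_coe.mp hg)))
    | zero =>
      rw [mul_zero]
      exact J.zero_mem
    | add x y _ _ hx hy =>
      rw [mul_add]
      exact J.add_mem hx hy
    | smul r x _ hx =>
      rw [smul_eq_mul, mul_left_comm]
      exact J.mul_mem_left r hx

end Summit.ResolutionOfSingularities.ResolutionOfSingularities.Theorems.FRationalResolution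

end
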